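import Literature.Algebra.Homology.ContCohomologyCentralExtension
import HarnessLib

/-!
# The transgression `Hom(A, Λ) → H²(G, Λ)` of a topological central extension

Companion of `ContCohomologyCentralExtension.lean` (same setting: a central extension
`1 → A → Ẽ →q→ B → 1` of topological groups, a continuous homomorphism `φ : G → B` of a test group and
a continuous LIFT `t : G → Ẽ`, `q ∘ t = φ`; factor set `c_t`, class `liftClass` in `H²(G, A)`).  For a
topological abelian group `Λ` with the TRIVIAL `G`-action, pushing the factor set along a continuous
homomorphism `χ : A → Λ` gives the **transgression**

  `transgression q φ t ht Λ hA : (Additive A →ₜ+ Λ) →+ H²(G, Λ)`,  `χ ↦ [χ ∘ c_t]`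

— the differential `Hom(A, Λ) = H⁰(G, H¹(A, Λ)) → H²(G, H⁰(A, Λ)) = H²(G, Λ)` of the
Hochschild–Serre spectral sequence of the extension in its elementary cocycle description
[cite: SerreGaloisCohomology1997, I §2.6 (b)] (the term `H¹(H, A)^{G/H} → H²(G/H, A^H)` of the exact
sequence of low degree), [cite: SerreGaloisCohomology1997, I §2.3] (factor sets).  Proved:

* `transgression_eq_map_liftClass`: `transgression χ` is the image of `liftClass` under the change of
  coefficients `χ` (Mathlib `ContinuousCohomology.map (id G) χ 2`); hence
  `transgression_liftChange`: independence of the lift (from `liftClass_eq`);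
* `transgression_pullback` (naturality in the test group: pulling back along `θ : H → G` is the
  transgression of the lift `t ∘ θ` of `φ ∘ θ`);
* `transgression_pushforward` (naturality in the extension: for a morphism of central extensions
  `ε : Ẽ → Ẽ'` over `ψ : B → B'`, the transgression of the lift `ε ∘ t` of `ψ ∘ φ` at `χ'` is the
  transgression of `t` at `χ' ∘ ε|_A`).
Together these give the equivariance of the transgression under automorphisms of the extension
(e.g. conjugation by `Π_{U_x}` on `1 → I_x → Δ^{c-cn}_{U_x} → Δ_X → 1`, [AbsTopIII] Prop. 1.4 (ii)),
which is what abc-iut-L4-t1 asked for (INBOX 2026-08-25T22:23:47Z (B)–(D)).  Generic; no anabelian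
content.
-/

noncomputable section

open CategoryTheory TopRep ContRepresentation Topology

namespace ContinuousCohomology

universe u v w

section Transgression

variable {E B : Type v} [Group E] [TopologicalSpace E] [IsTopologicalGroup E]
  [Group B] [TopologicalSpace B] [IsTopologicalGroup B] (q : E →ₜ* B)
  {G : Type v} [Group G] [TopologicalSpace G] [IsTopologicalGroup G]
  (φ : G →ₜ* B) (t : C(G, E)) (ht : ∀ g, q (t g) = φ g)
  (Λ : Type v) [AddCommGroup Λ] [TopologicalSpace Λ] [IsTopologicalAddGroup Λ]

variable (G) in
/-- The topological abelian group `Λ` with the TRIVIAL `G`-action, as an object of `TopRep ℤ G` (for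
`G = Δ_X` this is abc-iut-L4-t1's `geomTrivialRep`, verbatim). [cite: SerreGaloisCohomology1997, I §2.3] -/
abbrev trivCoeff : TopRep.{v} ℤ G := TopRep.of (ContRepresentation.trivial ℤ G Λ)

variable {Λ}

/-- The pushed factor set as a continuous function of three variables:
`(x, y, z) ↦ χ(c_t(x⁻¹y, y⁻¹z))`. [cite: SerreGaloisCohomology1997, I §2.3] -/
def pushFun₃ (χ : Additive (extKer q) →ₜ+ Λ) : C((G × G) × G, Λ) :=
  χ.toContinuousMap.comp (liftFun₃ q φ t ht)

/-- The pushed homogeneous `2`-cochain `(x, y, z) ↦ χ(c_t(x⁻¹y, y⁻¹z))` in curried form.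
[cite: SerreGaloisCohomology1997, I §2.3] -/
def pushCochain (χ : Additive (extKer q) →ₜ+ Λ) : C(G, C(G, C(G, Λ))) :=
  (pushFun₃ q φ t ht χ).curry.curry

omit [IsTopologicalGroup B] [IsTopologicalAddGroup Λ] in
/-- Value of the pushed cochain. [cite: SerreGaloisCohomology1997, I §2.3] -/
@[simp] theorem pushCochain_apply (χ : Additive (extKer q) →ₜ+ Λ) (x y z : G) :
    pushCochain q φ t ht χ x y z = χ (Additive.ofMul (factorSet q φ t ht (x⁻¹ * y) (y⁻¹ * z))) := rfl

omit [IsTopologicalGroup B] in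
/-- The pushed cochain is invariant (trivial action). [cite: SerreGaloisCohomology1997, I §2.3] -/
theorem pushCochain_mem_invariants (χ : Additive (extKer q) →ₜ+ Λ) :
    pushCochain q φ t ht χ ∈ (resolutionX (trivCoeff G Λ) 3).ρ.invariants := by
  intro g
  ext x y z
  change pushCochain q φ t ht χ (g⁻¹ * x) (g⁻¹ * y) (g⁻¹ * z) = pushCochain q φ t ht χ x y z
  simp only [pushCochain_apply, mul_inv_rev, inv_inv, mul_assoc, mul_inv_cancel_left]

omit [IsTopologicalGroup B] in
/-- The pushed cochain is a cocycle. [cite: SerreGaloisCohomology1997, I §2.3] -/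
theorem d_pushCochain (hA : ∀ a ∈ extKer q, ∀ e : E, e * a = a * e)
    (χ : Additive (extKer q) →ₜ+ Λ) :
    (d (trivCoeff G Λ) 3).hom (pushCochain q φ t ht χ) = 0 := by
  ext x y z w
  change pushCochain q φ t ht χ y z w - (pushCochain q φ t ht χ x z w -
    (pushCochain q φ t ht χ x y w - pushCochain q φ t ht χ x y z)) = 0
  simp only [pushCochain_apply]
  have key := factorSet_cocycle q φ t ht hA (x⁻¹ * y) (y⁻¹ * z) (z⁻¹ * w)
  have e1 : x⁻¹ * y * (y⁻¹ * z) = x⁻¹ * z := by rw [mul_assoc, mul_inv_cancel_left]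
  have e2 : y⁻¹ * z * (z⁻¹ * w) = y⁻¹ * w := by rw [mul_assoc, mul_inv_cancel_left]
  rw [e1, e2] at key
  have keyA : Additive.ofMul (factorSet q φ t ht (y⁻¹ * z) (z⁻¹ * w)) +
      Additive.ofMul (factorSet q φ t ht (x⁻¹ * y) (y⁻¹ * w)) =
      Additive.ofMul (factorSet q φ t ht (x⁻¹ * y) (y⁻¹ * z)) +
        Additive.ofMul (factorSet q φ t ht (x⁻¹ * z) (z⁻¹ * w)) := by
    rw [← ofMul_mul, ← ofMul_mul]
    exact congrArg Additive.ofMul (Subtype.ext key)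
  have key' := congrArg χ keyA
  rw [map_add, map_add, ← sub_eq_zero] at key'
  rw [← key']
  abel

/-- The pushed cochain as a homogeneous `2`-cochain of the trivial module `Λ`.
[cite: SerreGaloisCohomology1997, I §2.3] -/
def pushTwoCochain (χ : Additive (extKer q) →ₜ+ Λ) : (homogeneousCochains (trivCoeff G Λ)).X 2 :=
  ⟨pushCochain q φ t ht χ, pushCochain_mem_invariants q φ t ht χ⟩

omit [IsTopologicalGroup B] in
/-- Its differential vanishes. [cite: SerreGaloisCohomology1997, I §2.3] -/
theorem d_pushTwoCochain (hA : ∀ a ∈ extKer q, ∀ e : E, e * a = a * e)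
    (χ : Additive (extKer q) →ₜ+ Λ) :
    ((homogeneousCochains (trivCoeff G Λ)).d 2 3).hom (pushTwoCochain q φ t ht χ) = 0 := by
  apply Subtype.ext
  exact (homogeneousCochains.d_apply (trivCoeff G Λ) 2 (pushTwoCochain q φ t ht χ)).trans
    (d_pushCochain q φ t ht hA χ)

omit [IsTopologicalGroup B] in
/-- The pushed cochain is additive in `χ`. [cite: SerreGaloisCohomology1997, I §2.3] -/
theorem pushTwoCochain_add (χ χ' : Additive (extKer q) →ₜ+ Λ) :
    pushTwoCochain q φ t ht (χ + χ') = pushTwoCochain q φ t ht χ + pushTwoCochain q φ t ht χ' := by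
  apply Subtype.ext
  ext x y z
  rfl

/-- **The transgression** `Hom_cont(A, Λ) → H²(G, Λ)`, `χ ↦ [χ ∘ c_t]` (an additive homomorphism).
[cite: SerreGaloisCohomology1997, I §2.6 (b)] -/
def transgression (hA : ∀ a ∈ extKer q, ∀ e : E, e * a = a * e) :
    (Additive (extKer q) →ₜ+ Λ) →+ continuousCohomology 2 (trivCoeff G Λ) where
  toFun χ := ((homogeneousCochains (trivCoeff G Λ)).homologyπ 2).hom
    (cocycleMkTwo (trivCoeff G Λ) (pushTwoCochain q φ t ht χ) (d_pushTwoCochain q φ t ht hA χ))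
  map_zero' := by
    have h0 : cocycleMkTwo (trivCoeff G Λ) (pushTwoCochain q φ t ht 0)
        (d_pushTwoCochain q φ t ht hA 0) = 0 := by
      apply cocyclesTwo_ext (trivCoeff G Λ)
      rw [iCycles_cocycleMkTwo, map_zero]
      apply Subtype.ext
      ext x y z
      rfl
    rw [h0, map_zero]
  map_add' χ χ' := by
    rw [← map_add]
    congr 1
    apply cocyclesTwo_ext (trivCoeff G Λ)
    rw [map_add, iCycles_cocycleMkTwo, iCycles_cocycleMkTwo, iCycles_cocycleMkTwo]
    exact pushTwoCochain_add q φ t ht χ χ'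

omit [IsTopologicalGroup B] in
/-- Formula: `transgression χ = [χ ∘ c_t]`. [cite: SerreGaloisCohomology1997, I §2.6 (b)] -/
theorem transgression_apply (hA : ∀ a ∈ extKer q, ∀ e : E, e * a = a * e)
    (χ : Additive (extKer q) →ₜ+ Λ) :
    transgression q φ t ht hA χ = ((homogeneousCochains (trivCoeff G Λ)).homologyπ 2).hom
      (cocycleMkTwo (trivCoeff G Λ) (pushTwoCochain q φ t ht χ) (d_pushTwoCochain q φ t ht hA χ)) :=
  rfl

/-! ### Transgression = change of coefficients of the extension class; lift independence -/

/-- `χ : A → Λ` as a morphism of topological `G`-representations (both actions trivial).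
[cite: SerreGaloisCohomology1997, I §2.4] -/
def coeffHom (hA : ∀ a ∈ extKer q, ∀ e : E, e * a = a * e) (χ : Additive (extKer q) →ₜ+ Λ) :
    TopRep.res (ContinuousMonoidHom.id G : G →* G) (centralCoeff.{v} q G hA) ⟶ trivCoeff G Λ :=
  TopRep.ofHom
    { toContinuousLinearMap :=
        { toFun := fun a => χ a
          map_add' := fun a b => map_add χ a b
          map_smul' := fun c a => by
            change χ (c • a) = c • χ a
            exact map_zsmul χ c a
          cont := χ.continuous }
      isIntertwining' := fun _ => by
        ext v
        rfl }

omit [IsTopologicalGroup B] in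
/-- **`transgression χ` is the image of the extension/lift class under the change of coefficients
`χ`**. [cite: SerreGaloisCohomology1997, I §2.4] -/
theorem transgression_eq_map_liftClass (hA : ∀ a ∈ extKer q, ∀ e : E, e * a = a * e)
    (χ : Additive (extKer q) →ₜ+ Λ) :
    transgression q φ t ht hA χ =
      (ContinuousCohomology.map (ContinuousMonoidHom.id G) (coeffHom q hA χ) 2).hom
        (liftClass q φ t ht hA) := by
  rw [transgression_apply, liftClass]
  have hnat := congrArg (fun g => g.hom (cocycleMkTwo.{0, v, v} (centralCoeff.{v} q G hA)
      (liftTwoCochain q φ t ht hA) (d_liftTwoCochain q φ t ht hA)))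
    (HomologicalComplex.homologyπ_naturality
      (cochainsMap (ContinuousMonoidHom.id G) (coeffHom q hA χ)) 2)
  simp only [TopModuleCat.hom_comp, ContinuousLinearMap.coe_comp, Function.comp_apply] at hnat
  change _ = (HomologicalComplex.homologyMap
    (cochainsMap (ContinuousMonoidHom.id G) (coeffHom q hA χ)) 2).hom _
  rw [hnat]
  congr 1
  apply cocyclesTwo_ext (trivCoeff G Λ)
  have hi := congrArg (fun g => g.hom (cocycleMkTwo.{0, v, v} (centralCoeff.{v} q G hA)
      (liftTwoCochain q φ t ht hA) (d_liftTwoCochain q φ t ht hA)))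
    (HomologicalComplex.cyclesMap_i (cochainsMap (ContinuousMonoidHom.id G) (coeffHom q hA χ)) 2)
  simp only [TopModuleCat.hom_comp, ContinuousLinearMap.coe_comp, Function.comp_apply] at hi
  rw [iCycles_cocycleMkTwo, hi, iCycles_cocycleMkTwo]
  apply Subtype.ext
  ext x y z
  rfl

omit [IsTopologicalGroup B] in
/-- **The transgression does not depend on the lift** of `φ`.
[cite: SerreGaloisCohomology1997, I §2.6 (b)] -/
theorem transgression_liftChange (hA : ∀ a ∈ extKer q, ∀ e : E, e * a = a * e)
    (t' : C(G, E)) (ht' : ∀ g, q (t' g) = φ g) (χ : Additive (extKer q) →ₜ+ Λ) :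
    transgression q φ t' ht' hA χ = transgression q φ t ht hA χ := by
  rw [transgression_eq_map_liftClass, transgression_eq_map_liftClass, liftClass_eq q φ t ht t' ht' hA]

/-! ### Naturality in the test group (pull-back) -/

variable {H : Type v} [Group H] [TopologicalSpace H] [IsTopologicalGroup H]

variable (Λ) in
/-- The identity of `Λ` as a morphism from the restriction along `θ : H → G` of the trivial
`G`-module to the trivial `H`-module. [cite: SerreGaloisCohomology1997, I §2.4] -/
def trivResHom (θ : H →ₜ* G) : TopRep.res (θ : H →* G) (trivCoeff G Λ) ⟶ trivCoeff H Λ :=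
  TopRep.ofHom
    { toContinuousLinearMap := ContinuousLinearMap.id ℤ Λ
      isIntertwining' := fun _ => by
        ext v
        rfl }

omit [IsTopologicalGroup E] [IsTopologicalGroup B] [IsTopologicalGroup G] [IsTopologicalGroup H] in
include ht in
/-- A lift `t` of `φ` restricts along `θ : H → G` to the lift `t ∘ θ` of `φ ∘ θ`.
[cite: SerreGaloisCohomology1997, I §2.4] -/
theorem lift_comp (θ : H →ₜ* G) (h : H) : q ((t.comp θ.toContinuousMap) h) = (φ.comp θ) h := by
  change q (t (θ h)) = φ (θ h)
  exact ht (θ h)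

omit [IsTopologicalGroup E] [IsTopologicalGroup B] [IsTopologicalGroup G] [IsTopologicalGroup H] in
/-- The factor set of `t ∘ θ` is the factor set of `t` composed with `θ`.
[cite: SerreGaloisCohomology1997, I §2.4] -/
theorem factorSet_comp (θ : H →ₜ* G) (g h : H) :
    factorSet q (φ.comp θ) (t.comp θ.toContinuousMap) (lift_comp q φ t ht θ) g h =
      factorSet q φ t ht (θ g) (θ h) := by
  apply Subtype.ext
  change t (θ g) * t (θ h) * (t (θ (g * h)))⁻¹ = t (θ g) * t (θ h) * (t (θ g * θ h))⁻¹
  rw [map_mul]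

omit [IsTopologicalGroup B] in
/-- **Naturality of the transgression in the test group**: pulling `transgression_t χ ∈ H²(G, Λ)` back
along `θ : H → G` gives the transgression of the lift `t ∘ θ` of `φ ∘ θ`.
[cite: SerreGaloisCohomology1997, I §2.4] -/
theorem transgression_pullback (hA : ∀ a ∈ extKer q, ∀ e : E, e * a = a * e) (θ : H →ₜ* G)
    (χ : Additive (extKer q) →ₜ+ Λ) :
    (ContinuousCohomology.map θ (trivResHom Λ θ) 2).hom (transgression q φ t ht hA χ) =
      transgression q (φ.comp θ) (t.comp θ.toContinuousMap) (lift_comp q φ t ht θ) hA χ := by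
  rw [transgression_apply, transgression_apply]
  have hnat := congrArg (fun g => g.hom (cocycleMkTwo (trivCoeff G Λ) (pushTwoCochain q φ t ht χ)
      (d_pushTwoCochain q φ t ht hA χ)))
    (HomologicalComplex.homologyπ_naturality (cochainsMap θ (trivResHom Λ θ)) 2)
  simp only [TopModuleCat.hom_comp, ContinuousLinearMap.coe_comp, Function.comp_apply] at hnat
  change (HomologicalComplex.homologyMap (cochainsMap θ (trivResHom Λ θ)) 2).hom _ = _
  rw [hnat]
  congr 1
  apply cocyclesTwo_ext (trivCoeff H Λ)
  have hi := congrArg (fun g => g.hom (cocycleMkTwo (trivCoeff G Λ) (pushTwoCochain q φ t ht χ)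
      (d_pushTwoCochain q φ t ht hA χ)))
    (HomologicalComplex.cyclesMap_i (cochainsMap θ (trivResHom Λ θ)) 2)
  simp only [TopModuleCat.hom_comp, ContinuousLinearMap.coe_comp, Function.comp_apply] at hi
  rw [hi, iCycles_cocycleMkTwo, iCycles_cocycleMkTwo]
  apply Subtype.ext
  ext x y z
  change pushCochain q φ t ht χ (θ x) (θ y) (θ z) = pushCochain q (φ.comp θ) (t.comp θ.toContinuousMap)
    (lift_comp q φ t ht θ) χ x y z
  rw [pushCochain_apply, pushCochain_apply, factorSet_comp, map_mul, map_inv, map_mul, map_inv]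

/-! ### Naturality in the extension (push-forward along a morphism of central extensions) -/

variable {E' B' : Type v} [Group E'] [TopologicalSpace E'] [IsTopologicalGroup E']
  [Group B'] [TopologicalSpace B'] [IsTopologicalGroup B'] (q' : E' →ₜ* B')
  (ε : E →ₜ* E') (ψ : B →ₜ* B') (hεψ : ∀ e, q' (ε e) = ψ (q e))

omit [IsTopologicalGroup E] [IsTopologicalGroup B] [IsTopologicalGroup E'] [IsTopologicalGroup B'] in
include hεψ in
/-- A morphism of extensions maps the kernel to the kernel. [cite: SerreGaloisCohomology1997, I §2.4] -/
theorem map_mem_extKer {a : E} (ha : a ∈ extKer q) : ε a ∈ extKer q' := by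
  rw [MonoidHom.mem_ker] at ha ⊢
  change q' (ε a) = 1
  change q a = 1 at ha
  rw [hεψ, ha, map_one]

include hεψ in
/-- The induced continuous homomorphism `A → A'` on kernels (additive notation).
[cite: SerreGaloisCohomology1997, I §2.4] -/
def extKerMap : Additive (extKer q) →ₜ+ Additive (extKer q') where
  toFun a := Additive.ofMul ⟨ε (Additive.toMul a).1, map_mem_extKer q q' ε ψ hεψ (Additive.toMul a).2⟩
  map_zero' := by
    apply (Additive.toMul).injective
    apply Subtype.ext
    change ε 1 = 1
    exact map_one ε
  map_add' a b := by
    apply (Additive.toMul).injective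
    apply Subtype.ext
    change ε ((Additive.toMul a).1 * (Additive.toMul b).1) = ε (Additive.toMul a).1 * ε (Additive.toMul b).1
    exact map_mul ε _ _
  continuous_toFun := continuous_ofMul.comp (Continuous.subtype_mk
    (ε.continuous.comp (continuous_subtype_val.comp continuous_toMul)) _)

omit [IsTopologicalGroup E] [IsTopologicalGroup B] [IsTopologicalGroup G] [IsTopologicalGroup E']
  [IsTopologicalGroup B'] in
include ht hεψ in
/-- `ε ∘ t` is a lift of `ψ ∘ φ` to `Ẽ'`. [cite: SerreGaloisCohomology1997, I §2.4] -/
theorem lift_push (g : G) : q' ((ε.toContinuousMap.comp t) g) = (ψ.comp φ) g := by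
  change q' (ε (t g)) = ψ (φ g)
  rw [hεψ, ht]

omit [IsTopologicalGroup E] [IsTopologicalGroup B] [IsTopologicalGroup G] [IsTopologicalGroup E']
  [IsTopologicalGroup B'] in
/-- The factor set of `ε ∘ t` is `ε` applied to the factor set of `t`.
[cite: SerreGaloisCohomology1997, I §2.4] -/
theorem factorSet_push (g h : G) :
    (factorSet q' (ψ.comp φ) (ε.toContinuousMap.comp t) (lift_push q φ t ht q' ε ψ hεψ) g h : E') =
      ε (factorSet q φ t ht g h : E) := by
  change ε (t g) * ε (t h) * (ε (t (g * h)))⁻¹ = ε (t g * t h * (t (g * h))⁻¹)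
  rw [map_mul ε, map_mul ε, map_inv ε]

omit [IsTopologicalGroup B] [IsTopologicalGroup B'] in
/-- **Naturality of the transgression in the extension**: for a morphism `(ε, ψ)` of central
extensions and a lift `t` of `φ`, the transgression of the lift `ε ∘ t` of `ψ ∘ φ` at `χ' : A' → Λ` is
the transgression of `t` at `χ' ∘ ε|_A`. [cite: SerreGaloisCohomology1997, I §2.4] -/
theorem transgression_pushforward (hA : ∀ a ∈ extKer q, ∀ e : E, e * a = a * e)
    (hA' : ∀ a ∈ extKer q', ∀ e : E', e * a = a * e) (χ' : Additive (extKer q') →ₜ+ Λ) :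
    transgression q' (ψ.comp φ) (ε.toContinuousMap.comp t) (lift_push q φ t ht q' ε ψ hεψ) hA' χ' =
      transgression q φ t ht hA (χ'.comp (extKerMap q q' ε ψ hεψ)) := by
  rw [transgression_apply, transgression_apply]
  congr 1
  apply cocyclesTwo_ext (trivCoeff G Λ)
  rw [iCycles_cocycleMkTwo, iCycles_cocycleMkTwo]
  apply Subtype.ext
  ext x y z
  change pushCochain q' (ψ.comp φ) (ε.toContinuousMap.comp t) _ χ' x y z =
    pushCochain q φ t ht (χ'.comp (extKerMap q q' ε ψ hεψ)) x y z
  rw [pushCochain_apply, pushCochain_apply]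
  change _ = χ' (extKerMap q q' ε ψ hεψ (Additive.ofMul (factorSet q φ t ht (x⁻¹ * y) (y⁻¹ * z))))
  congr 1
  apply (Additive.toMul).injective
  apply Subtype.ext
  exact factorSet_push q φ t ht q' ε ψ hεψ (x⁻¹ * y) (y⁻¹ * z)

end Transgression

end ContinuousCohomology
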